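import Summits.BirchSwinnertonDyer.BirchSwinnertonDyer.Theorems.ByReductionTypeAtTwoEulerCharFormalBound
import Literature.NumberTheory.GaloisRepresentations.LocalDualityTwoZero
import Literature.NumberTheory.EllipticCurves.LocalWeilPairingDuality
import HarnessLib

/-!
# Route `ByReductionTypeAtTwo` (K4), TOWER road — Lemma 3.4 at layer `0`, the local count at `p = 2`, depth `1`:
# `2 ≤ #H²(ℚ_v, Ê[2])`

Cell `bsd-2adic`, seat `bsd-2adic-tower-1` (GEN 25), `--supports stmt-BirchSwinnertonDyer-19271` (helper). TOOL theorem only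
(no definition, no named fact, no `sorry`); closes nothing by itself; BSD is not proved by any of this. Part (g₁) of the
programme «Greenberg LNM 1716 Lemma 3.4 at layer `0` EXACT ⇒ Thm. 4.1 over `ℚ` ⇒ the `hEC` binder of the TOWER doors in the
kernel». After `…EulerCharFormalLower` (`#H²(Γ, Ê[p^k]) ≤ #(M₁/(g−1)M₁)[p^∞]`) the lower half of Lemma 3.4 at layer `0`
needs `p^{min(k, ord_p #Ẽ(𝔽_p))} ≤ #H²(Γ_{ℚ_v}, Ê[p^k])` (Tate duality + the Weil pairing on the ordinary line). This file does
the case `p = 2`, `k = 1`, where no Weil pairing is needed: `Ê[2] = {O, P₁}` and `μ₂ = {±1}` are TRIVIAL `Γ`-modules, so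
`Hom_Γ(Ê[2], μ₂) = Hom(ℤ/2, ℤ/2)` has two elements and `#H²(Γ, Ê[2]) = #Hom_Γ(Ê[2], μ₂) ≥ 2`
(`natCard_two_eq_natCard_invariants_homRep`). With `#Ẽ(𝔽₂) = 2` (`a₂ = 1`) this is the whole lower bound.

References: [GreenbergLNM1716] §3 Lemma 3.4 (p. 89); [MilneADT2006] I Cor. 2.3; [SerreGaloisCohomology1997] II §5.2.
-/

set_option autoImplicit false
-- the Theorems namespace of this sub repeats the summit name by design (D-0017 nested layout: Summit.<S>.<Sub>)
set_option linter.dupNamespace false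

noncomputable section

open scoped Classical NNReal

universe u

namespace Summit.BirchSwinnertonDyer.BirchSwinnertonDyer.Theorems.GoodOrdTower

open NumberField IsDedekindDomain Field _root_.ContinuousCohomology
  Literature.NumberTheory.EllipticCurves Literature.NumberTheory.GaloisRepresentations IsDedekindDomain.HeightOneSpectrum
  Literature.NumberTheory.GaloisRepresentations.DiscreteGaloisModule
  Literature.NumberTheory.EllipticCurves.Rank1Residual WeierstrassCurve Rat.HeightOneSpectrum

set_option maxHeartbeats 3200000 in
/-- **`2 ≤ #H²(Γ_{ℚ_v}, Ê[2])`** at the package level of `…EulerCharAssembly` with `p = 2` (`W/ℚ` globally minimal and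
elliptic with `GoodOrd W 2`, `v ∋ 2`, `w` spectral, `red₀` the reduction of `W_ℤ ⊗ 𝒪_w`), for `Z = ker red₀ ∩ E(K̄_v)[2]`
(`hZ`) and ANY continuous representation `ρ` of `Γ_{ℚ_v}` on `Z` (a group of order `2` carries only the trivial action). `Z = {O, P₁}` (the ordinary
filtration `localRed_ordinary_filtration`) and `μ₂ = {±1}` carry the trivial action, so the non-zero map `P₁ ↦ −1` is an
invariant of `Hom(Z, μ₂)`, and `#H²(Γ, Z) = #Hom_Γ(Z, μ₂) ≥ 2` by `natCard_two_eq_natCard_invariants_homRep`.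
[cite: GreenbergLNM1716, §3 Lemma 3.4 (p. 89)] [cite: MilneADT2006, I Cor. 2.3] -/
theorem two_le_natCard_H2_formalTorsion_two (v : HeightOneSpectrum (𝓞 ℚ)) (hpv : ((2 : ℕ) : 𝓞 ℚ) ∈ v.asIdeal)
    (W : WeierstrassCurve ℚ) [W.IsGloballyMinimal] [W.IsElliptic] (hgo : GoodOrd W 2)
    {w : Valuation (AlgebraicClosure (v.adicCompletion ℚ)) ℝ≥0}
    (hw : ∀ x, (w x : ℝ) = spectralNorm (v.adicCompletion ℚ) (AlgebraicClosure (v.adicCompletion ℚ)) x)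
    (red₀ : localPoints W (v.adicCompletion ℚ) →+
      (((integralModelInt W).map (algebraMap ℤ ↥w.valuationSubring)).map
        (IsLocalRing.residue ↥w.valuationSubring)).toAffine.Point)
    (hred₀ : ∀ P : localPoints W (v.adicCompletion ℚ), red₀ P =
      ((integralModelInt W).map (algebraMap ℤ ↥w.valuationSubring)).reducePoint
        (Affine.Point.congrEquiv (localIntModel_baseChange W w.valuationSubring).symm P))
    (Z : AddSubgroup (localPoints W (v.adicCompletion ℚ)))
    (hZ : ∀ a, a ∈ Z ↔ red₀ a = 0 ∧ 2 ^ 1 • a = 0)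
    (ρ : ContinuousRep (absoluteGaloisGroup (v.adicCompletion ℚ)) ℤ Z) :
    Finite (continuousCohomology 2 ρ.toTopRep) ∧ 2 ≤ Nat.card (continuousCohomology 2 ρ.toTopRep) := by
  haveI hp : Fact (Nat.Prime 2) := ⟨Nat.prime_two⟩
  let K := v.adicCompletion ℚ
  let Pt : Type := localPoints W K
  let Γ := absoluteGaloisGroup K
  -- the ordinary filtration at depth `2`: `Z = {O, P₁}`
  have hord : W.HasGoodReductionAtPrime 2 ∧ ¬ ((2 : ℕ) : ℤ) ∣ W.frobeniusTrace 2 := hgo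
  have hΔ : ¬ ((2 : ℕ) : ℤ) ∣ minimalDiscriminantInt W :=
    W.not_dvd_minimalDiscriminantInt_of_hasGoodReductionAtPrime' 2 hord.1
  have hvO : w.Integers w.valuationSubring := Valuation.valuationSubring.integers w
  have hΔu := W.isUnit_Δ_localIntModel hpv hw hΔ
  have hpO : w ((2 : ℕ) : AlgebraicClosure K) < 1 := by
    have h := spectralValuation_algebraMap_ringOfIntegers_lt_one (v := v) hw hpv
    rwa [map_natCast] at h
  haveI hchar : CharP (IsLocalRing.ResidueField ↥w.valuationSubring) 2 := by
    refine (CharP.charP_iff_prime_eq_zero hp.out).mpr ?_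
    rw [← map_natCast (IsLocalRing.residue ↥w.valuationSubring), IsLocalRing.residue_eq_zero_iff,
      IsLocalRing.mem_maximalIdeal, mem_nonunits_iff, hvO.isUnit_iff_valuation_eq_one, map_natCast]
    exact ne_of_lt hpO
  have hordA := W.exists_zsmul_eq_zero_localRed_ne_zero hw hΔu red₀ hred₀ hpv hΔ hord.2
  obtain ⟨hgenr, -, -⟩ := W.localRed_ordinary_filtration hΔu red₀ hred₀ hordA
  obtain ⟨P1, hP10, hP1ord, hP1gen⟩ := hgenr 1
  have hP12 : 2 ^ 1 • P1 = 0 := by rw [← hP1ord]; exact addOrderOf_nsmul_eq_zero P1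
  let Pz : Z := ⟨P1, (hZ P1).mpr ⟨hP10, hP12⟩⟩
  have hZgen : ∀ z : Z, ∃ i : ℕ, z = i • Pz := fun z ↦ by
    obtain ⟨c, hc⟩ := hP1gen z ((hZ _).mp z.2).1 (by rw [natCast_zsmul]; exact ((hZ _).mp z.2).2)
    exact ⟨c, Subtype.ext (by rw [AddSubmonoidClass.coe_nsmul]; exact hc)⟩
  have hPzord : addOrderOf Pz = 2 := by rw [← AddSubgroup.addOrderOf_coe Pz, hP1ord, pow_one]
  have hZ2 : ∀ z : Z, 2 • z = 0 := fun z ↦ Subtype.ext (by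
    rw [AddSubmonoidClass.coe_nsmul, ZeroMemClass.coe_zero, ← pow_one 2]; exact ((hZ z).mp z.2).2)
  have hZ2' : ∀ z : Z, 2 ^ 1 • z = 0 := fun z ↦ by rw [pow_one]; exact hZ2 z
  haveI hZfin : Finite Z := Nat.finite_of_card_ne_zero (by
    have h : (AddSubgroup.zmultiples Pz : AddSubgroup Z) = ⊤ := by
      rw [eq_top_iff]; intro z _
      obtain ⟨i, hi⟩ := hZgen z
      exact hi ▸ AddSubgroup.nsmul_mem _ (AddSubgroup.mem_zmultiples Pz) _
    rw [← AddSubgroup.card_top (G := Z), ← h, Nat.card_zmultiples, hPzord]; norm_num)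
  -- `Γ` acts trivially on `Z`
  have hPz0 : Pz ≠ 0 := fun h ↦ by
    have : addOrderOf Pz = 1 := by rw [h, addOrderOf_zero]
    rw [hPzord] at this; exact absurd this (by norm_num)
  have htrivZ : ∀ (σ : Γ) (z : Z), ρ σ z = z := by
    intro σ z
    obtain ⟨i, rfl⟩ := hZgen z
    rw [map_nsmul]
    congr 1
    -- `ρ σ Pz ∈ {0, Pz}` and `ρ σ Pz ≠ 0`
    obtain ⟨j, hj⟩ := hZgen (ρ σ Pz)
    rcases Nat.even_or_odd j with ⟨m, rfl⟩ | ⟨m, rfl⟩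
    · exfalso
      have h0 : ρ σ Pz = 0 := by rw [hj, ← two_mul, mul_nsmul', hZ2]
      have h1 : Pz = ρ σ⁻¹ (ρ σ Pz) := by
        rw [← Module.End.mul_apply, ← map_mul, inv_mul_cancel, map_one, Module.End.one_apply]
      rw [h0, map_zero] at h1
      exact hPz0 h1
    · rw [hj, add_nsmul, one_nsmul, mul_nsmul', hZ2, zero_add]
  -- duality: `#H²(Γ, Z) = #Hom_Γ(Z, μ₂)`
  haveI : CharZero K := charZero_of_injective_algebraMap (algebraMap ℚ K).injective
  obtain ⟨hfin2, hcard2⟩ := natCard_two_eq_natCard_invariants_homRep K ρ hZ2'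
  refine ⟨hfin2, ?_⟩
  rw [hcard2, pow_one]
  -- the module `μ₂`: `Γ` acts trivially
  haveI : NeZero (2 : ℕ) := ⟨two_ne_zero⟩
  haveI : Finite (MuCarrier K 2) := finite_muCarrier 2 K
  have htrivμ : ∀ (σ : Γ) (x : MuCarrier K 2), mu K 2 σ x = x := by
    intro σ x
    apply MuCarrier.toAdditive.injective
    rw [mu_apply_apply]
    refine congrArg Additive.ofMul (Subtype.ext (Units.ext ?_))
    rw [absoluteGaloisGroup.coe_smul_rootsOfUnity, Units.coe_smul]
    have hu : (((MuCarrier.toAdditive x).toMul : (AlgebraicClosure K)ˣ) : AlgebraicClosure K) ^ 2 = 1 := by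
      have h' := ((MuCarrier.toAdditive x).toMul).2
      rw [mem_rootsOfUnity] at h'
      rw [← Units.val_pow_eq_pow_val, h', Units.val_one]
    rw [sq] at hu
    rcases mul_self_eq_one_iff.mp hu with h1 | h1
    · rw [h1, smul_one]; exact h1.symm
    · rw [h1, smul_neg, smul_one]; exact h1.symm
  -- the non-zero element `η = −1 ∈ μ₂` and the map `f : i • P₁ ↦ i • η`
  have hneg1 : ((-1 : (AlgebraicClosure (v.adicCompletion ℚ))ˣ)) ∈ rootsOfUnity 2 (AlgebraicClosure (v.adicCompletion ℚ)) := by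
    rw [mem_rootsOfUnity]; norm_num
  let η : MuCarrier K 2 := MuCarrier.toAdditive.symm (Additive.ofMul ⟨-1, hneg1⟩)
  have hη : ((MuCarrier.toAdditive η).toMul : (AlgebraicClosure (v.adicCompletion ℚ))ˣ) = -1 := rfl
  have hη0 : η ≠ 0 := by
    intro h
    have h2 : ((MuCarrier.toAdditive η).toMul : (AlgebraicClosure (v.adicCompletion ℚ))ˣ) = 1 := by
      rw [h, map_zero, toMul_zero, OneMemClass.coe_one]
    rw [hη] at h2
    have h3 := congrArg (fun u : (AlgebraicClosure (v.adicCompletion ℚ))ˣ ↦ (u : AlgebraicClosure (v.adicCompletion ℚ)) + 1) h2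
    simp only [Units.val_neg, Units.val_one, neg_add_cancel] at h3
    norm_num at h3
  have hη2 : 2 • η = 0 := by
    apply MuCarrier.toAdditive.injective
    rw [map_nsmul, map_zero]
    have h1 : MuCarrier.toAdditive η = Additive.ofMul (⟨-1, hneg1⟩ : rootsOfUnity 2 (AlgebraicClosure (v.adicCompletion ℚ))) := rfl
    rw [h1, ← ofMul_pow, ofMul_eq_zero]
    exact Subtype.ext (Units.ext (by simp))
  have hη2n : ∀ n : ℕ, (2 * n) • η = 0 := fun n ↦ by
    induction n with
    | zero => rw [mul_zero, zero_nsmul]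
    | succ n ih => rw [Nat.mul_succ, add_nsmul, ih, hη2, add_zero]
  have hper : ∀ i j : ℕ, i • Pz = j • Pz → i • η = j • η := by
    intro i j hij
    rw [nsmul_eq_nsmul_iff_modEq, hPzord] at hij
    rw [← Nat.mod_add_div i 2, ← Nat.mod_add_div j 2, hij, add_nsmul, add_nsmul, hη2n, hη2n]
  choose idx hidx using hZgen
  let f : HomCarrier Z (MuCarrier K 2) :=
    { toFun := fun z ↦ idx z • η
      map_zero' := by
        have h := hper (idx 0) 0 (by rw [← hidx 0, zero_nsmul])
        rw [h, zero_nsmul]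
      map_add' := fun z z' ↦ by
        have h := hper (idx (z + z')) (idx z + idx z') (by rw [← hidx (z + z'), add_nsmul, ← hidx z, ← hidx z'])
        rw [h, add_nsmul] }
  have hf : ∀ z, f z = idx z • η := fun _ ↦ rfl
  have hfPz : f Pz = η := by
    rw [hf]
    have h := hper (idx Pz) 1 (by rw [← hidx Pz, one_nsmul])
    rw [h, one_nsmul]
  have hfinv : f ∈ (ρ.homRep (mu K 2)).toTopRep.ρ.invariants := fun σ ↦
    (ContinuousRep.homRep_apply_eq_self_iff ρ (mu K 2) σ f).mpr fun m ↦ by rw [htrivμ, htrivZ]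
  have h0inv : (0 : HomCarrier Z (MuCarrier K 2)) ∈ (ρ.homRep (mu K 2)).toTopRep.ρ.invariants := Submodule.zero_mem _
  have hne : (⟨f, hfinv⟩ : (ρ.homRep (mu K 2)).toTopRep.ρ.invariants) ≠ ⟨0, h0inv⟩ := by
    intro h
    have h' : f = 0 := congrArg Subtype.val h
    have h'' : f Pz = 0 := by rw [h']; rfl
    rw [hfPz] at h''
    exact hη0 h''
  haveI : Finite (HomCarrier Z (MuCarrier K 2)) :=
    Finite.of_injective (fun g : HomCarrier Z (MuCarrier K 2) ↦ (g : Z → MuCarrier K 2)) DFunLike.coe_injective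
  haveI : Finite (ρ.homRep (mu K 2)).toTopRep.ρ.invariants := Subtype.finite
  have h2 : Nat.card ({⟨f, hfinv⟩, ⟨0, h0inv⟩} : Finset (ρ.homRep (mu K 2)).toTopRep.ρ.invariants) = 2 := by
    rw [Nat.card_eq_fintype_card, Fintype.card_coe, Finset.card_pair hne]
  calc 2 = Nat.card ({⟨f, hfinv⟩, ⟨0, h0inv⟩} : Finset (ρ.homRep (mu K 2)).toTopRep.ρ.invariants) := h2.symm
    _ ≤ Nat.card (ρ.homRep (mu K 2)).toTopRep.ρ.invariants :=
        Nat.card_le_card_of_injective (fun x ↦ (x : (ρ.homRep (mu K 2)).toTopRep.ρ.invariants)) Subtype.val_injective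

end Summit.BirchSwinnertonDyer.BirchSwinnertonDyer.Theorems.GoodOrdTower

end
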